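import Summits.Ventures.QEC.Census.CertCoverChecks
import Summits.Ventures.QEC.Census.BB.BB288.CoverAuts
import Summits.Ventures.QEC.Census.BB.BB288.CoverReps
import Summits.Ventures.QEC.Census.BB.BB288.CoverFound2A
import Summits.Ventures.QEC.Census.BB.BB288.CoverFound2B
import Summits.Ventures.QEC.Census.BB.BB288.CoverWit2A
import Summits.Ventures.QEC.Census.BB.BB288.CoverWit2B
import HarnessLib

set_option Elab.async false

/-!
# `[[288,12,18]]` cover certificate — VERDICT of the level-2 witness table (`wit2_ok`): every FOUND₂ word is carried by a listed
translation shadow to its level-2→1 representative, and the table lists `0 :: FOUND₂` in order.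
(Split out of the frozen CoverWitOK by qec-search-9 g4: the joint file exceeds the default heartbeat budget on the farm —
`permWord ∘ permFun` walks a 72-entry table per bit, ≈ 2.5e7 kernel steps for 9 496 witnesses; theorem NAMES unchanged.)
-/

namespace Summit.Ventures.QEC.Census.BB288Cover

open Summit.Ventures.QEC.Census

set_option maxHeartbeats 400000000 in
/-- The level-2 witness table is valid and lists FOUND₂ in order. -/
theorem wit2_ok : witnessOK 72 permqqs reps2 (wit2a ++ wit2b) = true ∧ ((wit2a ++ wit2b).map CoverWitness.w = 0 :: (found2a ++ found2b)) := by
  refine ⟨?_, ?_⟩ <;> decide +kernel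

end Summit.Ventures.QEC.Census.BB288Cover
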